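import Summits.NavierStokesRegularity.NavierStokesRegularity.Theorems.SelfMixingDichotomyCoherentScaleExclusionStructure
import Literature.Analysis.FluidPDE.SereginSverak2002ACriterion

/-!
# Route SelfMixingDichotomy — crux `CoherentScaleExclusion` (S2), regime (I) of the birth line
(stub `stub_coherentWindowExclusion`: Type-I windows inside a cascade)

What the tree supports in regime (I) — recurrent bounded-load scales (`liminf C < ∞`) together
with unbounded load (`limsup C = ∞`) at a final-time point `(T, x₀)` of a finite-energy classical
solution — is the SMALL-WINDOW exclusion WITH PRESSURE: the one-scale `ε`-regularity criterion of
Caffarelli–Kohn–Nirenberg in Lemarié-Rieusset's backward form (Thm. 14.4, PROVED in the tree as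
`lemarieRieusset_epsilon_regularity_holds`) applies on the cylinder `Q_r(T, x₀) ⊆ (0,T) × (EuclideanSpace ℝ (Fin 3))`
itself, so ONE scale `r` with `C(r) + D(r) ≤ ε*` (`C = cknC`, `D = cknD` of the given pressure)
makes `u` bounded on `Q_{r/2}(T, x₀)` (`coherentWindowRegime_bdd_of_oneScale`); boundedness gives
a load ceiling (`coherentScaleExclusion_loadCeiling_of_bdd`), which unbounded load violates
(`coherentWindowRegime_small`). The velocity-only window (`C(r) ≤ ε*` at one scale, no pressure)
would need Wolf's pressure-free `ε`-regularity criterion (Ann. Univ. Ferrara 61 (2015)), which has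
no counterpart in the tree; the general window regime is the content of the sibling crux
`SequentialTypeIExclusion` (S1), see `coherentWindowRegime_of_sequentialTypeIExclusion`.
-/

noncomputable section

namespace Summit.NavierStokesRegularity.NavierStokesRegularity.Theorems

set_option linter.dupNamespace false

open MeasureTheory Filter Set Metric Function TopologicalSpace
open scoped ENNReal NNReal InnerProductSpace RealInnerProductSpace Laplacian
open Literature.Analysis.FluidPDE
open Summit.NavierStokesRegularity.NavierStokesRegularity.Theses.SelfMixingDichotomy

/-- **One-scale `ε`-regularity at the final time, for classical Leray–Hopf solutions.** There is a
universal `ε > 0` such that: if `(u, p)` is a classical solution of the unforced Navier–Stokes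
system (`ν = 1`) on `(EuclideanSpace ℝ (Fin 3)) × [0, T)` which is Leray–Hopf on `[0, T]`, `x₀ ∈ (EuclideanSpace ℝ (Fin 3))`, `0 < r`, `r² ≤ T`,
and at the ONE scale `r` the cubic load and the pressure load are jointly small,
`cknC r (T, x₀) u + cknD r (T, x₀) p ≤ ofReal ε`, then `u` is bounded on the backward cylinder
`(T - (r/2)², T) × B(x₀, r/2)`. Proof: on `Q = Q_r(T, x₀) ⊆ (0, T) × (EuclideanSpace ℝ (Fin 3))` the pair `(u, p)` is a
suitable weak solution (`SereginSverak2002.isSuitableWeakSolutionOn_of_classical`), in the global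
classes on `Q` (energy bound of the Leray–Hopf solution, its square-integrable weak spatial
gradient `IsLerayHopfOn.exists_hasWeakSpatialGradientOn`, `∫∫_Q |p|^{3/2} < ∞` from `D(r) < ∞`);
Lemarié-Rieusset's Thm. 14.4 (`lemarieRieusset_epsilon_regularity_holds`, `ν = 1`, `q = 3`,
`f = 0`, `λ = ε₁`, `ε = ε₁³`) bounds `u` a.e. on `Q_{r/2}(T, x₀)`, everywhere by continuity of `u`
below `T`. [cite: LemarieRieusset2016, Thm. 14.4 p. 505] -/
theorem coherentWindowRegime_bdd_of_oneScale :
    ∃ ε : ℝ, 0 < ε ∧ ∀ T : ℝ, 0 < T →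
      ∀ (u : ℝ → (EuclideanSpace ℝ (Fin 3)) → (EuclideanSpace ℝ (Fin 3))) (p : ℝ → (EuclideanSpace ℝ (Fin 3)) → ℝ),
      IsClassicalNSSolutionOn (Set.Ico 0 T) 1 0 u p → IsLerayHopfOn T 1 0 (u 0) u →
      ∀ (x₀ : (EuclideanSpace ℝ (Fin 3))) (r : ℝ), 0 < r → r ^ 2 ≤ T →
      cknC r ((T, x₀) : ℝ × (EuclideanSpace ℝ (Fin 3))) u + cknD r ((T, x₀) : ℝ × (EuclideanSpace ℝ (Fin 3))) p ≤ ENNReal.ofReal ε →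
      ∀ t ∈ Set.Ioo (T - (r / 2) ^ 2) T, ∀ x ∈ Metric.ball x₀ (r / 2),
        ‖u t x‖ ≤ (eLpNormEssSup (uncurry u)
          (volume.restrict (parabolicCylinder (r / 2) ((T, x₀) : ℝ × (EuclideanSpace ℝ (Fin 3)))))).toReal := by
  obtain ⟨ε₁, C₀, hε₁, -, H⟩ := lemarieRieusset_epsilon_regularity_holds 1 3 one_pos (by norm_num)
  refine ⟨ε₁ ^ 3, by positivity, fun T hT u p hsol hLH x₀ r hr hrT hsmall => ?_⟩
  -- the cylinder `Q = Q_r(T, x₀)` inside the open slab `(0, T) × (EuclideanSpace ℝ (Fin 3))`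
  set Q : Opens (ℝ × (EuclideanSpace ℝ (Fin 3))) := parabolicCylinderOpens r ((T, x₀) : ℝ × (EuclideanSpace ℝ (Fin 3))) with hQdef
  have hQ : (Q : Set (ℝ × (EuclideanSpace ℝ (Fin 3)))) = parabolicCylinder r ((T, x₀) : ℝ × (EuclideanSpace ℝ (Fin 3))) := rfl
  have hQslab : (Q : Set (ℝ × (EuclideanSpace ℝ (Fin 3)))) ⊆ Ioo 0 T ×ˢ (univ : Set (EuclideanSpace ℝ (Fin 3))) := by
    rw [hQ, parabolicCylinder]
    rintro ⟨t, x⟩ ⟨⟨ht1, ht2⟩, -⟩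
    exact ⟨⟨by simp only at ht1; linarith, ht2⟩, mem_univ _⟩
  -- `(u, p)` is a suitable weak solution on `Q`
  have hsws : IsSuitableWeakSolutionOn Q 1 0 u p :=
    SereginSverak2002.isSuitableWeakSolutionOn_of_classical hsol Q hQslab
  have hconn : IsConnected (Q : Set (ℝ × (EuclideanSpace ℝ (Fin 3)))) :=
    Literature.Analysis.FluidPDE.isConnected_parabolicCylinder hr _
  -- the energy class on `Q`, in indicator form
  have hCE : ∀ᵐ t : ℝ, t ∈ Ioo (T - r ^ 2) T →
      ∫⁻ x in ball x₀ r, ‖u t x‖ₑ ^ 2 ≤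
        ((2 * VectorCalculus.kineticEnergy (u 0)).toNNReal : ℝ≥0∞) := by
    refine Eventually.of_forall fun t ht => ?_
    have htc : t ∈ Icc 0 T := ⟨by nlinarith [ht.1], ht.2.le⟩
    calc ∫⁻ x in ball x₀ r, ‖u t x‖ₑ ^ 2 ≤ ∫⁻ x, ‖u t x‖ₑ ^ 2 := setLIntegral_le_lintegral _ _
      _ ≤ ENNReal.ofReal (2 * VectorCalculus.kineticEnergy (u 0)) :=
          SereginSverak2002.eEnergy_le zero_le_one hLH htc
      _ = ((2 * VectorCalculus.kineticEnergy (u 0)).toNNReal : ℝ≥0∞) := rfl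
  have hE : ∃ C : ℝ≥0, ∀ᵐ t : ℝ, ∫⁻ x, (Q : Set (ℝ × (EuclideanSpace ℝ (Fin 3)))).indicator
      (fun z : ℝ × (EuclideanSpace ℝ (Fin 3)) => ‖u z.1 z.2‖ₑ ^ 2) (t, x) ≤ C := by
    refine ⟨(2 * VectorCalculus.kineticEnergy (u 0)).toNNReal, ?_⟩
    rw [hQ, parabolicCylinder]
    exact ae_lintegral_indicator_prod_le measurableSet_ball hCE
  -- the Leray–Hopf weak spatial gradient, square integrable on `Q`
  obtain ⟨G, hGslab, -, hGint, -⟩ := hLH.exists_hasWeakSpatialGradientOn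
  have hle : Q ≤ slab (EuclideanSpace ℝ (Fin 3)) (Ioo 0 T) isOpen_Ioo := by
    intro z hz
    change z ∈ Ioo 0 T ×ˢ (univ : Set (EuclideanSpace ℝ (Fin 3)))
    exact hQslab hz
  have hG : HasWeakSpatialGradientOn Q u G := hGslab.mono hle
  have hGsq : ∫⁻ z in (Q : Set (ℝ × (EuclideanSpace ℝ (Fin 3)))), ENNReal.ofReal (frobeniusNormSq (G z.1 z.2)) < ∞ :=
    lt_of_le_of_lt (lintegral_mono_set hQslab) hGint
  -- the pressure class on `Q`, from `D(r) < ∞`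
  have hr2_0 : ENNReal.ofReal r ^ 2 ≠ 0 := pow_ne_zero _ (ENNReal.ofReal_pos.2 hr).ne'
  have hr2_t : ENNReal.ofReal r ^ 2 ≠ ∞ := ENNReal.pow_ne_top ENNReal.ofReal_ne_top
  have hP : ∫⁻ z in (Q : Set (ℝ × (EuclideanSpace ℝ (Fin 3)))), ‖p z.1 z.2‖ₑ ^ (3 / 2 : ℝ) < ∞ := by
    have hD : cknD r ((T, x₀) : ℝ × (EuclideanSpace ℝ (Fin 3))) p < ∞ :=
      lt_of_le_of_lt le_add_self (hsmall.trans_lt ENNReal.ofReal_lt_top)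
    rw [cknD] at hD
    rcases ENNReal.mul_lt_top_iff.1 hD with h | h | h
    · exact h.2
    · exact absurd h (ENNReal.inv_ne_zero.2 hr2_t)
    · rw [hQ, h]; exact ENNReal.zero_lt_top
  -- the zero force, the equations, the local energy inequality with `G`
  have hf : MemLp (uncurry (0 : ℝ → (EuclideanSpace ℝ (Fin 3)) → (EuclideanSpace ℝ (Fin 3)))) (ENNReal.ofReal 3)
      (volume.restrict (Q : Set (ℝ × (EuclideanSpace ℝ (Fin 3))))) :=
    (MemLp.zero : MemLp (0 : ℝ × (EuclideanSpace ℝ (Fin 3)) → (EuclideanSpace ℝ (Fin 3))) (ENNReal.ofReal 3) (volume.restrict (Q : Set (ℝ × (EuclideanSpace ℝ (Fin 3))))))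
  have hdist : IsDistributionalNSSolutionOn Q 1 0 u p := hsws.distributional
  have hLEI := SereginSverak2009.localEnergyIneq_of_isSuitable hsws hG
  -- smallness in the form (14.17) with `λ = ε₁`
  have hum : AEMeasurable (fun w : ℝ × (EuclideanSpace ℝ (Fin 3)) => ‖u w.1 w.2‖ₑ ^ (3 : ℕ))
      (volume.restrict (parabolicCylinder r ((T, x₀) : ℝ × (EuclideanSpace ℝ (Fin 3))))) := by
    have h1 : AEStronglyMeasurable (uncurry u) (volume.restrict (Q : Set (ℝ × (EuclideanSpace ℝ (Fin 3))))) :=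
      hdist.1.aestronglyMeasurable
    exact h1.aemeasurable.enorm.pow_const 3
  have hUP : ∫⁻ w in parabolicCylinder r ((T, x₀) : ℝ × (EuclideanSpace ℝ (Fin 3))),
      (‖u w.1 w.2‖ₑ ^ (3 : ℕ) + ‖p w.1 w.2‖ₑ ^ (3 / 2 : ℝ)) ≤ ENNReal.ofReal (ε₁ ^ 3 * r ^ 2) := by
    set I : ℝ≥0∞ := ∫⁻ w in parabolicCylinder r ((T, x₀) : ℝ × (EuclideanSpace ℝ (Fin 3))),
      (‖u w.1 w.2‖ₑ ^ (3 : ℕ) + ‖p w.1 w.2‖ₑ ^ (3 / 2 : ℝ)) with hI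
    have h1 : (ENNReal.ofReal r ^ 2)⁻¹ * I ≤ ENNReal.ofReal (ε₁ ^ 3) := by
      rw [hI, lintegral_add_left' hum, mul_add]
      exact hsmall
    calc I = (ENNReal.ofReal r ^ 2 * (ENNReal.ofReal r ^ 2)⁻¹) * I := by
          rw [ENNReal.mul_inv_cancel hr2_0 hr2_t, one_mul]
      _ = ENNReal.ofReal r ^ 2 * ((ENNReal.ofReal r ^ 2)⁻¹ * I) := mul_assoc _ _ _
      _ ≤ ENNReal.ofReal r ^ 2 * ENNReal.ofReal (ε₁ ^ 3) := mul_le_mul_right h1 _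
      _ = ENNReal.ofReal (ε₁ ^ 3 * r ^ 2) := by
          rw [← ENNReal.ofReal_pow hr.le, ← ENNReal.ofReal_mul (by positivity), mul_comm]
  have hF : ∫⁻ w in parabolicCylinder r ((T, x₀) : ℝ × (EuclideanSpace ℝ (Fin 3))),
      ‖(0 : ℝ → (EuclideanSpace ℝ (Fin 3)) → (EuclideanSpace ℝ (Fin 3))) w.1 w.2‖ₑ ^ (3 : ℝ) ≤
      ENNReal.ofReal (ε₁ ^ (2 * (3 : ℝ)) * r ^ (5 - 3 * (3 : ℝ))) := by
    have : (fun w : ℝ × (EuclideanSpace ℝ (Fin 3)) => ‖(0 : ℝ → (EuclideanSpace ℝ (Fin 3)) → (EuclideanSpace ℝ (Fin 3))) w.1 w.2‖ₑ ^ (3 : ℝ)) = fun _ => 0 := by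
      funext w
      simp [ENNReal.zero_rpow_of_pos (by norm_num : (0 : ℝ) < 3)]
    rw [this, lintegral_zero]
    exact bot_le
  -- Thm. 14.4 on `Q` at `((T, x₀), r, λ = ε₁)`: an essential bound on `Q_{r/2}(T, x₀)`
  have key := H Q 0 u p G hconn hE hG hGsq hP hf hdist hLEI ((T, x₀) : ℝ × (EuclideanSpace ℝ (Fin 3))) r ε₁ hr
    (by rw [hQ]) hε₁.le le_rfl hUP hF
  -- the essential supremum is finite, and bounds `u` a.e., hence everywhere by continuity
  set M : ℝ≥0∞ := eLpNormEssSup (uncurry u)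
    (volume.restrict (parabolicCylinder (r / 2) ((T, x₀) : ℝ × (EuclideanSpace ℝ (Fin 3))))) with hM
  have hMtop : M < ∞ := eLpNormEssSup_lt_top_of_ae_bound key
  have hae : ∀ᵐ z ∂(volume.restrict (parabolicCylinder (r / 2) ((T, x₀) : ℝ × (EuclideanSpace ℝ (Fin 3))))),
      ‖uncurry u z‖ ≤ M.toReal := by
    filter_upwards [ae_le_eLpNormEssSup (f := uncurry u)
      (μ := volume.restrict (parabolicCylinder (r / 2) ((T, x₀) : ℝ × (EuclideanSpace ℝ (Fin 3)))))] with z hz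
    have := ENNReal.toReal_mono hMtop.ne hz
    rwa [toReal_enorm] at this
  have hsubIco : parabolicCylinder (r / 2) ((T, x₀) : ℝ × (EuclideanSpace ℝ (Fin 3))) ⊆ Ico 0 T ×ˢ (univ : Set (EuclideanSpace ℝ (Fin 3))) := by
    rw [parabolicCylinder]
    rintro ⟨t, x⟩ ⟨⟨ht1, ht2⟩, -⟩
    exact ⟨⟨by simp only at ht1; nlinarith, ht2⟩, mem_univ _⟩
  have hcont : ContinuousOn (uncurry u) (parabolicCylinder (r / 2) ((T, x₀) : ℝ × (EuclideanSpace ℝ (Fin 3)))) :=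
    (SereginSverak2002.continuousOn_uncurry hsol).mono hsubIco
  have hall := SereginSverak2002.norm_le_of_ae_restrict_of_continuousOn
    (isOpen_parabolicCylinder (r / 2) ((T, x₀) : ℝ × (EuclideanSpace ℝ (Fin 3)))) hcont hae
  intro t ht x hx
  exact hall (t, x) (mk_mem_prod ht hx)

/-- **Regime (I), small windows with pressure: Type-I windows at the CKN threshold are excluded.**
There is a universal `ε > 0` such that no final-time point `(T, x₀)` of a finite-energy classical
solution (`ν = 1`, Leray–Hopf on `[0, T]`, rapidly decaying datum) carries simultaneously
(i') recurrent `ε`-small scales WITH pressure, `cknC r (T,x₀) u + cknD r (T,x₀) p ≤ ofReal ε` for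
arbitrarily small `r`, and (ii) unbounded load, `ofReal M'' < cknC r (T,x₀) u` infinitely often for
every `M''`: one small scale gives boundedness near `(T, x₀)`
(`coherentWindowRegime_bdd_of_oneScale`), hence a load ceiling
(`coherentScaleExclusion_loadCeiling_of_bdd`), which (ii) violates. This is the part of the
registered stub `stub_coherentWindowExclusion` (hypothesis (i) there: `cknC r ≤ ofReal M'` only,
any `M'`, no pressure) that the tree's `ε`-regularity theory covers; the coherence hypothesis
(iii) of the stub is not needed. [cite: LemarieRieusset2016, Thm. 14.4 p. 505] -/
theorem coherentWindowRegime_small :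
    ∃ ε : ℝ, 0 < ε ∧ ∀ T : ℝ, 0 < T → ∀ (u : ℝ → EuclideanSpace ℝ (Fin 3) → EuclideanSpace ℝ (Fin 3)) (p : ℝ → EuclideanSpace ℝ (Fin 3) → ℝ), Literature.Analysis.FluidPDE.IsClassicalNSSolutionOn (Set.Ico 0 T) 1 0 u p → Literature.Analysis.FluidPDE.IsLerayHopfOn T 1 0 (u 0) u → Literature.Analysis.FluidPDE.HasRapidSpatialDecay (u 0) → ∀ x₀ : EuclideanSpace ℝ (Fin 3), (∀ r₁ : ℝ, 0 < r₁ → ∃ r ∈ Set.Ioo 0 r₁, Literature.Analysis.FluidPDE.cknC r ((T, x₀) : ℝ × EuclideanSpace ℝ (Fin 3)) u + Literature.Analysis.FluidPDE.cknD r ((T, x₀) : ℝ × EuclideanSpace ℝ (Fin 3)) p ≤ ENNReal.ofReal ε) → (∀ M'' r₁ : ℝ, 0 < r₁ → ∃ r ∈ Set.Ioo 0 r₁, ENNReal.ofReal M'' < Literature.Analysis.FluidPDE.cknC r ((T, x₀) : ℝ × EuclideanSpace ℝ (Fin 3)) u) → False := by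
  obtain ⟨ε, hε, H⟩ := coherentWindowRegime_bdd_of_oneScale
  refine ⟨ε, hε, fun T hT u p hsol hLH _hdec x₀ hwin hunb => ?_⟩
  -- one small scale `r < min 1 T`, so that `r² ≤ T`
  obtain ⟨r, hr, hsmall⟩ := hwin (min 1 T) (lt_min one_pos hT)
  have hr1 : r < 1 := lt_of_lt_of_le hr.2 (min_le_left _ _)
  have hrT : r ^ 2 ≤ T := by nlinarith [hr.1, lt_of_lt_of_le hr.2 (min_le_right 1 T)]
  -- boundedness near `(T, x₀)`
  have hbdd : ∃ ρ : ℝ, 0 < ρ ∧ ∃ M : ℝ, ∀ t ∈ Set.Ioo (T - ρ ^ 2) T, ∀ x ∈ Metric.ball x₀ ρ,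
      ‖u t x‖ ≤ M :=
    ⟨r / 2, by linarith [hr.1], _, H T hT u p hsol hLH x₀ r hr.1 hrT hsmall⟩
  -- the load ceiling contradicts unbounded load
  obtain ⟨M₁, r₁, hr₁, hC⟩ := coherentScaleExclusion_loadCeiling_of_bdd hbdd
  obtain ⟨r', hr', hlt⟩ := hunb M₁ r₁ hr₁
  exact absurd (hC r' hr') (not_le.2 hlt)

end Summit.NavierStokesRegularity.NavierStokesRegularity.Theorems

end
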